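import Literature.NumberTheory.FaltingsSerre.Paramodular349
import Literature.NumberTheory.FaltingsSerre.ConjCertificate
import HarnessLib

/-!
# `A₃₄₉` is paramodular of level `349` away from `349`, from a certificate up to a residual change of frame

[BPPTVY] = A. Brumer, A. Pacetti, C. Poor, G. Tornaría, J. Voight, D. S. Yuen, *On the paramodularity of
typical abelian surfaces*, Algebra & Number Theory **13**:5 (2019) 1145–1195 [cite: BrumerEtAl2019].

The `N = 349` instance of the frame-free template `paramodular_of_surfaceConjCertificate_holds`
(`ConjCertificate.lean`): the certificate hypothesis is `ConjCertificate349 ν ρA ρf :=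
SurfaceConjCertificate 349 checkPrimes349 ν ρA ρf` — Gram matrix FIXED to `J = antiIdAlt4 ℤ_[2]`, and
Step 1 in the form the frozen certificate `certs/349/certificate.canonical.json` (sha256
`0b9d070d407f6211ba094695ef509e92c9ce0838fa2e62a6110db86c60cabd92`, block `residual`, Route T) actually
establishes: `ρ̄_f = ι(π) ρ̄_A ι(π)⁻¹` for some `π ∈ S₆` (constructor `ConjCertificate.ofTransvection` of
`ConjCertificateRoutes.lean` from: same `2`-division field, an order-`5` element, a common transvection).
The input `hρf` (the cited `ρ_{f,2}` of [BPPTVY, Thm 4.3.4 + Lemma 4.3.8(b) p. 1171], Arthur-dependent) is about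
`ρf` in its own symplectic frame; the criterion hypothesis is discharged by
`traceEq_of_faltingsSerre_symplectic_holds`.  Check primes and all other data as in `Paramodular349.lean`.
No new mathematics; paramodularity of `A₃₄₉` is not a published theorem, so the certificate stays a binder.
-/

noncomputable section

namespace Literature.NumberTheory.FaltingsSerre.Paramodular349

open Polynomial IsDedekindDomain
open Literature.NumberTheory.FaltingsSerre Literature.NumberTheory.GaloisRepresentations
  Literature.NumberTheory.Automorphic.Paramodular Literature.NumberTheory.Automorphic
  Literature.AlgebraicGeometry.Motives
open scoped NumberField

/-- **The `N = 349` certificate up to frame, as a hypothesis**: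
`SurfaceConjCertificate 349 checkPrimes349 ν ρA ρf` (`J = antiIdAlt4 ℤ_[2]`; Step 1 as residual
conjugacy inside `ι(S₆)`, Steps 2–5 as in `Certificate349`). [cite: BrumerEtAl2019, Alg 2.4.1 p. 1156; §2.3 p. 1149] -/
def ConjCertificate349 (ν : Field.absoluteGaloisGroup ℚ → ℤ_[2]) (ρA ρf : FramedGaloisRep ℚ ℤ_[2] 4) :
    Prop :=
  SurfaceConjCertificate 349 checkPrimes349 ν ρA ρf

/-- A strict certificate with `J = antiIdAlt4 ℤ_[2]` gives one up to frame. [cite: BrumerEtAl2019, Alg 2.4.1 p. 1156] -/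
theorem conjCertificate349_of_certificate349 {ν : Field.absoluteGaloisGroup ℚ → ℤ_[2]}
    {ρA ρf : FramedGaloisRep ℚ ℤ_[2] 4} (hC : Certificate349 (GSp4F2.antiIdAlt4 ℤ_[2]) ν ρA ρf) :
    ConjCertificate349 ν ρA ρf :=
  ConjCertificate.ofCertificate hC

/-- **`A₃₄₉` is paramodular of level `349` away from `349`, from the certificate up to frame — criterion
discharged.**  Binders as in `paramodular_349_holds` / `paramodular_349` except `hC : ConjCertificate349 ν ρA ρf`
and `hρf` about `ρf` in its own frame. [cite: BrumerEtAl2019, Thm 2.1.5 p. 1150; §2.3 p. 1149; Alg 2.4.1 p. 1156; Thm 4.3.4 p. 1169] -/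
theorem paramodular_349_of_conjCertificate
    {A : AbelianVariety ℚ} {f : Matrix (Fin 2) (Fin 2) ℂ → ℂ}
    {ρA ρf : FramedGaloisRep ℚ ℤ_[2] 4} {ν : Field.absoluteGaloisGroup ℚ → ℤ_[2]}
    {b : Module.Basis (Fin 4) ℚ_[2] (A.rationalTateModule 2)}
    (hC : ConjCertificate349 ν ρA ρf)
    (hframe : A.IsFrameOfTateRep 2 b (rationalize ρA))
    (aA bA af bf : ℕ → ℤ)
    (hA : ∀ p : ℕ, p.Prime → ¬ p ∣ 349 →
      A.HasGoodEulerFactorAt p ((lPolynomialOfSurface p (aA p) (bA p)).map (Int.castRingHom ℚ)))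
    (hρf : ∀ p : ℕ, p.Prime → ¬ p ∣ 349 → p ≠ 2 →
      ∀ v : HeightOneSpectrum (𝓞 ℚ), ((p : ℕ) : 𝓞 ℚ) ∈ v.asIdeal →
        ρf.HasFrobCharpolyAt v
          ((lPolynomialOfSurface p (af p) (bf p)).reverse.map (Int.castRingHom ℤ_[2])))
    (hcusp : IsParamodularCuspForm 349 2 f) (hne : ∃ Z ∈ siegelUpperHalfSpace 2, f Z ≠ 0)
    (hfe : ∀ p : ℕ, p.Prime → ¬ p ∣ 349 →
      HasSpinorEulerFactorAt 2 p f ((lPolynomialOfSurface p (af p) (bf p)).map (Int.castRingHom ℂ)))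
    (h2 : aA 2 = af 2 ∧ bA 2 = bf 2) :
    IsParamodularAwayFrom A 349 f :=
  paramodular_of_surfaceConjCertificate_holds hC hframe aA bA af bf hA hρf hcusp hne hfe (fun _ => h2)

end Literature.NumberTheory.FaltingsSerre.Paramodular349

end
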